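import Summits.ABC.IUTFork.LDHPerPrimeReading
import Literature.IUT.LogVolume.Corollary22TwoAdicIntegrality
import HarnessLib

/-!
# The fork at [IUTchIII] Corollary 3.12, L-DH level: NON-VACUITY of the deep-place refutation — synthetic inputs

Record-only file (D-0012) of the abc-iut cell (WAVE-5 prover abc-iut-w5-d157); TAKES NO SIDE on Cor. 3.12. Sequel to
`LDHPerPrimeReading.lean` (`not_perPrimeReading_of_ordq_large_of_finrank_eq_one`: over a degree-one base with ONE place `v₀`
over `p`, the per-prime reading "`−|log(q)|_p ≤ −|log(Θ)|_p`" of Dupuy–Hilado (1.1)/[IUTchIII] Cor. 3.12 fails for a GENUINE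
Θ-volume input as soon as `(c_l − 1)·ord_{v₀}(q_{v₀})·ln N(v₀)/(2l)` exceeds the `ord(q)`-free constant `D_p(I)`). Here the
hypothesis is shown SATISFIABLE in the input type of abc-iut-S2's `GenuineLogTheta`:
* `PilotData.deepAt` — synthetic pilot data `j_E := p^{−2lN}`, `S := V(F₀)_p`, prime `l ≥ 5`, so `ord_v(q_v) = 2lN·e_v` at every
  `v | p` (`deepAt_ordq`, via `Cor22.ord_natCast_eq_ramIdx`);
* `ThetaVolumeInput.deepAt` — over ANY section `σ` of the places of a number field `K ⊇ F₀`: the ideles `t_{Θ,j,v} := p^{j²N}`,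
  `t_{q,v} := p^N` in the GENUINE completions `K_{v̲}` at `v | p` (`1` elsewhere) realise `P_Θ`, `P_q` exactly, because
  `ord_v(p) = e_v` in `K_{v̲}` (`LocalFields.ordv_prime`);
* `ThetaVolumeInput.exists_deepAt_not_perPrimeReading` — for `[F₀:ℚ] = 1`, every `σ`, `p`, `l`: SOME depth `N` makes the
  per-prime (hence every per-packet) reading FAIL at `p` (Archimedes: the `q`-side grows linearly in `N`, `D_p` does not move).
HONEST SCOPE: these are inhabitants of the INPUT TYPE chosen for their valuations; it is NOT claimed that they are the Θ-volume
inputs of collections of initial Θ-data of [IUTchI] Def. 3.1 (there `K = F(E_F[l])` for an elliptic curve with `j`-invariant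
`j_E`, and the ideles are `2l`-th roots of Tate parameters); nothing here bears on whether [IUTchIII] Thm. 3.11 licenses (1.1).
[cite: DupuyHilado2025, §1 (1.1), §3.3, §3.9, Thm. 3.10.1] [claim: Mochizuki2012, status: disputed] for every IUT quotation.
-/

noncomputable section

open Set NumberField IsDedekindDomain Literature.IUT.LogVolume

namespace Summit.ABC.IUTFork

section Witness

variable (F₀ : Type) [Field F₀] [NumberField F₀] {K : Type} [Field K] [NumberField K] [Algebra F₀ K]

/-- **Synthetic pilot data with one deep bad prime**: `j_E := (p^{2lN})⁻¹`, `S := V(F₀)_p` (all places over `p`),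
the prime `l ≥ 5`; so `ord_v(q_v) = 2lN·e_v` at every `v | p`. An inhabitant of c312-3's `PilotData` chosen for its
valuations — NOT claimed to come from a specific elliptic curve. [cite: DupuyHilado2025, §3.2–3.3] -/
def PilotData.deepAt (p : ℕ) [Fact p.Prime] (l : ℕ) (hl : l.Prime) (h5 : 5 ≤ l) (N : ℕ) (hN : 0 < N) :
    PilotData F₀ where
  jE := ((p : F₀) ^ (2 * l * N))⁻¹
  S := placesOver F₀ p
  S_nonempty := placesOver_nonempty F₀ p
  ord_jE_neg := fun v hv => by
    rw [ord_inv, ord_pow, Cor22.ord_natCast_eq_ramIdx p v hv]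
    have h1 : (0 : ℤ) < ramIdx F₀ v := by exact_mod_cast Nat.pos_of_ne_zero (ramIdx_ne_zero F₀ v)
    have h2 : (0 : ℤ) < (2 * l * N : ℕ) := by exact_mod_cast (by positivity : 0 < 2 * l * N)
    nlinarith
  l := l
  l_prime := hl
  five_le_l := h5

variable {F₀}
variable (p : ℕ) [hp : Fact p.Prime] (l : ℕ) (hl : l.Prime) (h5 : 5 ≤ l) (N : ℕ) (hN : 0 < N)

/-- `ord_v(q_v) = 2lN·e_v` at `v | p` for the synthetic pilot data. [cite: DupuyHilado2025, §3.3] -/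
theorem PilotData.deepAt_ordq (v : HeightOneSpectrum (𝓞 F₀)) (hv : v ∈ placesOver F₀ p) :
    (PilotData.deepAt F₀ p l hl h5 N hN).ordq v = 2 * l * N * ramIdx F₀ v := by
  show -ord F₀ v (((p : F₀) ^ (2 * l * N))⁻¹) = _
  rw [ord_inv, ord_pow, Cor22.ord_natCast_eq_ramIdx p v hv]
  push_cast
  ring

open scoped Classical in
/-- Evaluation of the Θ-pilot coefficients of any pilot data. [cite: DupuyHilado2025, §3.3] -/
theorem PilotData.thetaPilot_apply' (X : PilotData F₀) (i : Fin X.lstar) (v : HeightOneSpectrum (𝓞 F₀)) :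
    X.thetaPilot i v = if v ∈ X.S then (((i : ℕ) + 1 : ℝ) ^ 2) * (X.ordq v : ℝ) / (2 * X.l) else 0 := by
  classical
  show (∑ w ∈ X.S, FinDivisor.of w ((((i : ℕ) + 1 : ℝ) ^ 2) * (X.ordq w : ℝ) / (2 * X.l))) v = _
  rw [Finsupp.finsetSum_apply]
  split_ifs with hv
  · rw [Finset.sum_eq_single v (fun u _ huv => Finsupp.single_eq_of_ne (Ne.symm huv)) (fun h => absurd hv h)]
    exact Finsupp.single_eq_same
  · exact Finset.sum_eq_zero fun u hu => Finsupp.single_eq_of_ne (fun h => hv (h ▸ hu))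

open scoped Classical in
/-- Evaluation of the `q`-pilot coefficients of any pilot data. [cite: DupuyHilado2025, §3.3] -/
theorem PilotData.qPilot_apply' (X : PilotData F₀) (v : HeightOneSpectrum (𝓞 F₀)) :
    X.qPilot v = if v ∈ X.S then (X.ordq v : ℝ) / (2 * X.l) else 0 := by
  classical
  show (∑ w ∈ X.S, FinDivisor.of w ((X.ordq w : ℝ) / (2 * X.l))) v = _
  rw [Finsupp.finsetSum_apply]
  split_ifs with hv
  · rw [Finset.sum_eq_single v (fun u _ huv => Finsupp.single_eq_of_ne (Ne.symm huv)) (fun h => absurd hv h)]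
    exact Finsupp.single_eq_same
  · exact Finset.sum_eq_zero fun u hu => Finsupp.single_eq_of_ne (fun h => hv (h ▸ hu))

/-- The unit `p` of a member of a local-field family at `p` (`‖p‖ = p⁻¹ ≠ 0`). [cite: DupuyHilado2025, §2.4.2] -/
def LocalFields.primeUnit' {p : ℕ} [Fact p.Prime] (𝔽 : LocalFields F₀ p) (v : placesOver F₀ p) : (𝔽.k v)ˣ :=
  Units.mk0 (p : 𝔽.k v) (prime_ne_zero p (𝔽.k v))

/-- `ord_v(p^n) = n·e_v` in a local-field family. [cite: DupuyHilado2025, §2.4.2] -/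
theorem LocalFields.ordv_primeUnit'_pow {p : ℕ} [Fact p.Prime] (𝔽 : LocalFields F₀ p) (v : placesOver F₀ p) (n : ℕ) :
    𝔽.ordv (LocalFields.primeUnit' 𝔽 v ^ n) = n * ramIdx F₀ v.1 := by
  induction n with
  | zero => simp [LocalFields.ordv]
  | succ n ih =>
    rw [pow_succ, LocalFields.ordv_mul, ih, LocalFields.primeUnit', LocalFields.ordv_prime]
    push_cast
    ring

open scoped Classical in
/-- **A SYNTHETIC Θ-volume input with one deep bad prime** over any section `σ` of the places of `K / F₀`: the pilot
data `PilotData.deepAt` (`j_E = p^{−2lN}`, `S = V(F₀)_p`) with the ideles `t_{Θ,j,v} := p^{j²N}`, `t_{q,v} := p^N` in the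
GENUINE completions `K_{v̲}` at `v | p` (and `1` elsewhere) — they realise `P_Θ`, `P_q` because `ord_v(p) = e_v`. An
inhabitant of the INPUT TYPE (abc-iut-S2's `ThetaVolumeInput`), exhibited for non-vacuity; NOT claimed to be the input of a
collection of initial Θ-data of [IUTchI] Def. 3.1 (there `K = F(E_F[l])` for an elliptic curve with `j`-invariant `j_E`).
[cite: DupuyHilado2025, §3.9] -/
def ThetaVolumeInput.deepAt (σ : PlaceSection F₀ K) : ThetaVolumeInput F₀ K where
  X := PilotData.deepAt F₀ p l hl h5 N hN
  σ := σ
  tΘ p' hp' i v := (@LocalFields.primeUnit' F₀ _ _ p' ⟨hp'⟩ (σ.localFieldFamily p' hp') v) ^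
    (if v.1 ∈ placesOver F₀ p then ((i : ℕ) + 1) ^ 2 * N else 0)
  tΘ_ord p' hp' i v := by
    haveI : Fact p'.Prime := ⟨hp'⟩
    rw [LocalFields.ordv_primeUnit'_pow, PilotData.thetaPilot_apply']
    change (((if v.1 ∈ placesOver F₀ p then ((i : ℕ) + 1) ^ 2 * N else 0 : ℕ) : ℝ) * ramIdx F₀ v.1 =
      if v.1 ∈ placesOver F₀ p then _ else 0)
    split_ifs with hv
    · rw [PilotData.deepAt_ordq p l hl h5 N hN v.1 hv]
      change _ = (((i : ℕ) + 1 : ℝ) ^ 2) * ((2 * l * N * ramIdx F₀ v.1 : ℤ) : ℝ) / (2 * (l : ℕ))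
      have hl0 : (l : ℝ) ≠ 0 := by exact_mod_cast hl.ne_zero
      push_cast
      field_simp
    · simp
  tq p' hp' i v := (@LocalFields.primeUnit' F₀ _ _ p' ⟨hp'⟩ (σ.localFieldFamily p' hp') v) ^
    (if v.1 ∈ placesOver F₀ p then N else 0)
  tq_ord p' hp' i v := by
    haveI : Fact p'.Prime := ⟨hp'⟩
    rw [LocalFields.ordv_primeUnit'_pow, PilotData.qPilot_apply']
    change (((if v.1 ∈ placesOver F₀ p then N else 0 : ℕ) : ℝ) * ramIdx F₀ v.1 =
      if v.1 ∈ placesOver F₀ p then _ else 0)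
    split_ifs with hv
    · rw [PilotData.deepAt_ordq p l hl h5 N hN v.1 hv]
      change _ = ((2 * l * N * ramIdx F₀ v.1 : ℤ) : ℝ) / (2 * (l : ℕ))
      have hl0 : (l : ℝ) ≠ 0 := by exact_mod_cast hl.ne_zero
      push_cast
      field_simp
    · simp

/-- The synthetic input's procession length is `(l−1)/2`, whatever `N`. [cite: DupuyHilado2025, §3.3] -/
theorem ThetaVolumeInput.deepAt_lstar (σ : PlaceSection F₀ K) :
    (ThetaVolumeInput.deepAt p l hl h5 N hN σ).X.lstar = (l - 1) / 2 := rfl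

/-- **NON-VACUITY: over a degree-one base (`F₀ ≃ ℚ`) the per-prime reading FAILS for the synthetic inputs of large
depth.** For every number field `K ⊇ F₀` with `[F₀:ℚ] = 1`, every section `σ`, every prime `p` and prime `l ≥ 5` there is a
depth `N` such that the synthetic input `deepAt p l N σ` (`j_E = p^{−2lN}`) violates "`−|log(q)|_p ≤ −|log(Θ)|_p`" — so every
per-packet reading of (1.1)/[IUTchIII] Cor. 3.12 fails at `p` for it. A statement about the INPUT TYPE and the genuine
completions `K_{v̲}`; it does not assert that these inputs come from initial Θ-data, and takes no side on Cor. 3.12.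
[cite: DupuyHilado2025, §1 (1.1), Thm. 3.10.1] [claim: Mochizuki2012, status: disputed] -/
theorem ThetaVolumeInput.exists_deepAt_not_perPrimeReading (hF : Module.finrank ℚ F₀ = 1) (σ : PlaceSection F₀ K) :
    ∃ (N : ℕ) (hN : 0 < N), ¬ (ThetaVolumeInput.deepAt p l hl h5 N hN σ).negAbsLogQLoc p ≤
      (ThetaVolumeInput.deepAt p l hl h5 N hN σ).negLogThetaLoc p := by
  obtain ⟨w, hw⟩ := placesOver_nonempty F₀ p
  let v₀ : placesOver F₀ p := ⟨w, hw⟩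
  -- the `N`-free constants: `D` (the bound of `explicitDeltaAt_le_of_subsingleton`) and the slope `A`
  set L : ℕ := (l - 1) / 2 with hLdef
  set d₀ : ℝ := differentOrd p ((σ.localFieldFamily p hp.out).k v₀) with hd₀
  set e₀ : ℕ := absRamificationIdx p ((σ.localFieldFamily p hp.out).k v₀) with he₀
  set D : ℝ := (((L : ℝ) + 3) / 2 * d₀ + 1) * Real.log p + ((L : ℝ) + 3) / 2 * (3 + Real.log (e₀ : ℝ)) with hD
  set A : ℝ := ((((L : ℝ) + 1) * (2 * L + 1) / 6) - 1) * (ramIdx F₀ w * logNorm F₀ w) with hA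
  have hL2 : (2 : ℝ) ≤ L := by
    have := (PilotData.deepAt F₀ p l hl h5 1 Nat.one_pos).two_le_lstar
    exact_mod_cast this
  have hApos : 0 < A := by
    have h1 : (0 : ℝ) < ramIdx F₀ w := by exact_mod_cast Nat.pos_of_ne_zero (ramIdx_ne_zero F₀ w)
    have h2 : 0 < logNorm F₀ w := logNorm_pos F₀ w
    have h3 : (0 : ℝ) < (((L : ℝ) + 1) * (2 * L + 1) / 6) - 1 := by nlinarith
    positivity
  obtain ⟨N, hN⟩ := exists_nat_gt (D / A)
  refine ⟨N + 1, Nat.succ_pos N, ?_⟩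
  refine DHData.not_perPrimeReading_of_ordq_large_of_finrank_eq_one (ThetaVolumeInput.deepAt p l hl h5 (N + 1) (Nat.succ_pos N) σ)
    hF v₀ hw ?_
  show D < ((((L : ℝ) + 1) * (2 * L + 1) / 6) - 1) *
    (((PilotData.deepAt F₀ p l hl h5 (N + 1) (Nat.succ_pos N)).ordq w : ℝ) / (2 * (l : ℕ)) * logNorm F₀ w)
  rw [PilotData.deepAt_ordq p l hl h5 (N + 1) (Nat.succ_pos N) w hw]
  have hl0 : (l : ℝ) ≠ 0 := by exact_mod_cast hl.ne_zero
  have hkey : ((((L : ℝ) + 1) * (2 * L + 1) / 6) - 1) *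
      (((2 * l * (N + 1 : ℕ) * ramIdx F₀ w : ℤ) : ℝ) / (2 * (l : ℕ)) * logNorm F₀ w) = A * ((N : ℝ) + 1) := by
    rw [hA]
    push_cast
    field_simp
  rw [hkey]
  have h1 : D < A * N := ((div_lt_iff₀ hApos).mp hN).trans_eq (mul_comm _ _)
  nlinarith

end Witness

end Summit.ABC.IUTFork

end
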